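import Literature.Analysis.Fourier.PaleyWienerHalfPlane
import Mathlib.Analysis.Distribution.AEEqOfIntegralContDiff
import Mathlib.MeasureTheory.Function.L2Space
import Mathlib.MeasureTheory.Measure.OpenPos
import HarnessLib

/-!
# Spectral consequences of a phase symmetry of a boundary function

Topic `Literature/Analysis/Fourier`. Elementary Fourier bookkeeping for the explicit multiplier
construction (Jin–Zhang, arXiv:1710.00250, Lemma 11 and the end of the proof of Theorem 12, in
the form "`f = c f̄ e^{2πiσx}` forces `supp f̂ ⊂ [0, σ]`"), stated for a pair `(φ, g)` of `L²`
functions linked by the weak Plancherel pairing `∫ φ η = ∫ g 𝓕η` (`η ∈ L¹ ∩ L²`), which is how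
the boundary function `g` of a holomorphic function on the upper half-plane and its spectral
function `φ` are related (`PaleyWienerHalfPlane.lean`):

* `fourier_conj_comp_sub` — `𝓕(v ↦ conj η(τ - v))(x) = e^{-2πiτx} conj(𝓕η(x))`;
* `ae_eq_zero_of_pairing_of_phase_symmetry` — if moreover `g = -e^{2πiτ·} conj g` a.e. and
  `φ = 0` on `(-∞, 0)`, then `φ = 0` a.e. on `(τ, ∞)`;
* `fourier_comp_const_sub` — `𝓕(v ↦ φ(σ - v))(ξ) = e^{-2πiσξ} 𝓕⁻φ(ξ)`, so the moduli agree;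
* `le_of_ae_le_of_continuous` — an a.e. inequality between continuous functions holds everywhere.

All statements are folklore; no definitions are introduced.
-/

namespace Literature.Analysis.Fourier

open _root_.MeasureTheory Set Filter _root_.Complex
open scoped FourierTransform Real Topology ComplexConjugate

section Symmetry

/-- **Fourier transform of a conjugated reflection**:
`𝓕(v ↦ conj η(τ - v))(x) = exp(-2πiτx) · conj (𝓕 η x)`. [folklore] -/
theorem fourier_conj_comp_sub (η : ℝ → ℂ) (τ x : ℝ) :
    𝓕 (fun v : ℝ => conj (η (τ - v))) x =
      cexp (↑(-2 * π * τ * x) * I) * conj (𝓕 η x) := by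
  rw [Real.fourier_real_eq_integral_exp_smul, Real.fourier_real_eq_integral_exp_smul]
  -- substitute `v ↦ τ - v`
  have hsub : ∫ v : ℝ, cexp (↑(-2 * π * v * x) * I) • conj (η (τ - v)) =
      ∫ u : ℝ, cexp (↑(-2 * π * (τ - u) * x) * I) • conj (η u) := by
    have := integral_sub_left_eq_self (fun u : ℝ => cexp (↑(-2 * π * (τ - u) * x) * I) • conj (η u))
      volume τ
    rw [← this]
    refine integral_congr_ae (ae_of_all _ fun v => ?_)
    simp only [sub_sub_cancel]
  rw [hsub, ← integral_conj, ← integral_const_mul]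
  refine integral_congr_ae (ae_of_all _ fun u => ?_)
  simp only [smul_eq_mul, map_mul, ← Complex.exp_conj, map_mul, Complex.conj_ofReal, Complex.conj_I]
  rw [← mul_assoc, ← Complex.exp_add]
  congr 1
  congr 1
  push_cast
  ring

/-- An a.e. inequality between continuous real functions holds everywhere (Lebesgue measure
charges open sets). [folklore] -/
theorem le_of_ae_le_of_continuous {f W : ℝ → ℝ} (hf : Continuous f) (hW : Continuous W)
    (h : ∀ᵐ x : ℝ, f x ≤ W x) (x : ℝ) : f x ≤ W x := by
  by_contra hx
  push Not at hx
  have hopen : IsOpen {y : ℝ | W y < f y} := isOpen_lt hW hf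
  have hpos : 0 < volume {y : ℝ | W y < f y} := hopen.measure_pos volume ⟨x, hx⟩
  have hnull : volume {y : ℝ | W y < f y} = 0 := by
    rw [ae_iff] at h
    convert h using 2
    ext y
    simp only [mem_setOf_eq, not_le]
  exact hpos.ne' hnull

/-- **Phase symmetry halves the spectrum.** Let `φ, g ∈ L²(ℝ)` satisfy the weak Plancherel
pairing `∫ φ η = ∫ g 𝓕η` for all `η ∈ L¹ ∩ L²`, let `φ = 0` on `(-∞, 0)`, and suppose
`g = -e^{2πiτ·} conj g` a.e. Then `φ(ζ) + conj φ(τ - ζ) = 0` a.e., hence `φ = 0` a.e. on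
`(τ, ∞)`. (Jin–Zhang arXiv:1710.00250, proof of Lemma 11, in weak form.) [folklore] -/
theorem ae_eq_zero_of_pairing_of_phase_symmetry {φ g : ℝ → ℂ} (hφ : MemLp φ 2 volume)
    (hpair : ∀ η : ℝ → ℂ, Integrable η → MemLp η 2 volume → ∫ ξ, φ ξ * η ξ = ∫ x, g x * 𝓕 η x)
    (hzero : ∀ ξ, ξ < 0 → φ ξ = 0) {τ : ℝ}
    (hsym : ∀ᵐ x : ℝ, g x = -(cexp (↑(2 * π * τ * x) * I) * conj (g x))) :
    ∀ᵐ ζ : ℝ, τ < ζ → φ ζ = 0 := by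
  -- the reflected conjugate
  set F : ℝ → ℂ := fun ζ => φ ζ + conj (φ (τ - ζ)) with hF
  have hφr : MemLp (fun ζ => conj (φ (τ - ζ))) 2 volume := by
    have h1 : MemLp (fun ζ => φ (τ - ζ)) 2 volume :=
      hφ.comp_measurePreserving (Measure.measurePreserving_sub_left volume τ)
    exact ⟨Complex.continuous_conj.comp_aestronglyMeasurable h1.1, by
      rw [show (fun ζ => conj (φ (τ - ζ))) = fun ζ => (starRingEnd ℂ) (φ (τ - ζ)) from rfl]
      have := h1.2
      rwa [eLpNorm_congr_norm_ae (Eventually.of_forall fun ζ => (Complex.norm_conj (φ (τ - ζ))))]⟩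
  have hFloc : LocallyIntegrable F volume := (hφ.add hφr).locallyIntegrable (by norm_num)
  -- weak vanishing of `F` against real test functions
  have hweak : ∀ (ρ : ℝ → ℝ), ContDiff ℝ (⊤ : ℕ∞) ρ → HasCompactSupport ρ → ∫ ζ, ρ ζ • F ζ = 0 := by
    intro ρ hρ hρs
    set η : ℝ → ℂ := fun ζ => (ρ ζ : ℂ) with hη
    have hηc : Continuous η := Complex.continuous_ofReal.comp hρ.continuous
    have hηs : HasCompactSupport η := hρs.comp_left Complex.ofReal_zero
    have hηi : Integrable η := hηc.integrable_of_hasCompactSupport hηs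
    have hη2 : MemLp η 2 volume := hηc.memLp_of_hasCompactSupport hηs
    -- the reflected test function `η♯(ξ) = conj η(τ - ξ)`
    set η' : ℝ → ℂ := fun ξ => conj (η (τ - ξ)) with hη'
    have hη'c : Continuous η' := Complex.continuous_conj.comp (hηc.comp (continuous_sub_left τ))
    have hη's : HasCompactSupport η' := by
      have h1 : HasCompactSupport (fun ξ => η (τ - ξ)) := hηs.comp_homeomorph (Homeomorph.subLeft τ)
      exact h1.comp_left (map_zero _)
    have hη'i : Integrable η' := hη'c.integrable_of_hasCompactSupport hη's
    have hη'2 : MemLp η' 2 volume := hη'c.memLp_of_hasCompactSupport hη's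
    -- pairing for `η` and `η'`
    have h1 := hpair η hηi hη2
    have h2 := hpair η' hη'i hη'2
    -- `∫ conj φ(τ - ζ) · η ζ = conj ∫ φ · η'`
    have h3 : ∫ ζ, conj (φ (τ - ζ)) * η ζ = conj (∫ ξ, φ ξ * η' ξ) := by
      rw [← integral_conj]
      have : ∫ ζ, conj (φ (τ - ζ)) * η ζ = ∫ ξ, conj (φ ξ) * η (τ - ξ) := by
        have := integral_sub_left_eq_self (fun ξ => conj (φ ξ) * η (τ - ξ)) volume τ
        rw [← this]
        refine integral_congr_ae (ae_of_all _ fun ζ => ?_)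
        simp only [sub_sub_cancel]
      rw [this]
      refine integral_congr_ae (ae_of_all _ fun ξ => ?_)
      simp only [hη', map_mul, Complex.conj_conj]
    -- `conj ∫ g · 𝓕η' = -∫ g · 𝓕η` by the phase symmetry
    have h4 : conj (∫ x, g x * 𝓕 η' x) = -∫ x, g x * 𝓕 η x := by
      rw [← integral_conj, ← integral_neg]
      refine integral_congr_ae ?_
      filter_upwards [hsym] with x hx
      rw [hη', fourier_conj_comp_sub η τ x, map_mul, map_mul, Complex.conj_conj, ← Complex.exp_conj,
        map_mul, Complex.conj_ofReal, Complex.conj_I]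
      -- `exp(2πiτx) · conj g(x) = -g(x)`
      have hx2 : cexp (↑(2 * π * τ * x) * I) * conj (g x) = -g x := by linear_combination hx
      have hexp : cexp (↑(-2 * π * τ * x) * -I) = cexp (↑(2 * π * τ * x) * I) := by
        congr 1; push_cast; ring
      calc conj (g x) * (cexp (↑(-2 * π * τ * x) * -I) * 𝓕 η x)
          = (cexp (↑(2 * π * τ * x) * I) * conj (g x)) * 𝓕 η x := by rw [hexp]; ring
        _ = -(g x * 𝓕 η x) := by rw [hx2]; ring
    -- assemble
    have hi1 : Integrable fun ζ => φ ζ * η ζ :=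
      (integrable_norm_mul_norm_of_memLp_two hφ hη2).mono' (hφ.1.mul hη2.1)
        (Eventually.of_forall fun ζ => by rw [norm_mul])
    have hi2 : Integrable fun ζ => conj (φ (τ - ζ)) * η ζ :=
      (integrable_norm_mul_norm_of_memLp_two hφr hη2).mono' (hφr.1.mul hη2.1)
        (Eventually.of_forall fun ζ => by rw [norm_mul])
    have h5 : ∫ ζ, F ζ * η ζ = 0 := by
      have : ∫ ζ, F ζ * η ζ = (∫ ζ, φ ζ * η ζ) + ∫ ζ, conj (φ (τ - ζ)) * η ζ := by
        rw [← integral_add hi1 hi2]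
        refine integral_congr_ae (ae_of_all _ fun ζ => ?_)
        rw [hF]; ring
      rw [this, h3, h2, h4, h1]
      ring
    have h6 : ∫ ζ, ρ ζ • F ζ = ∫ ζ, F ζ * η ζ := by
      refine integral_congr_ae (ae_of_all _ fun ζ => ?_)
      show ρ ζ • F ζ = F ζ * (ρ ζ : ℂ)
      rw [Complex.real_smul]; ring
    rw [h6, h5]
  have hae := ae_eq_zero_of_integral_contDiff_smul_eq_zero hFloc hweak
  filter_upwards [hae] with ζ hζ hτζ
  have h0 : φ (τ - ζ) = 0 := hzero _ (by linarith)
  have : F ζ = φ ζ + conj (φ (τ - ζ)) := rfl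
  rw [this, h0, map_zero, add_zero] at hζ
  exact hζ

end Symmetry

/-! ### From the spectral function to the compactly supported multiplier -/

section Packaging

/-- **Fourier transform of a reflected translate**: `𝓕(v ↦ φ(σ - v))(ξ) = e^{-2πiσξ} 𝓕⁻φ(ξ)`.
[folklore] -/
theorem fourier_comp_const_sub (φ : ℝ → ℂ) (σ ξ : ℝ) :
    𝓕 (fun v : ℝ => φ (σ - v)) ξ = cexp (↑(-2 * π * σ * ξ) * I) * 𝓕⁻ φ ξ := by
  rw [Real.fourier_real_eq_integral_exp_smul, Real.fourierInv_eq_fourier_neg,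
    Real.fourier_real_eq_integral_exp_smul]
  have hsub : ∫ v : ℝ, cexp (↑(-2 * π * v * ξ) * I) • φ (σ - v) =
      ∫ u : ℝ, cexp (↑(-2 * π * (σ - u) * ξ) * I) • φ u := by
    have := integral_sub_left_eq_self (fun u : ℝ => cexp (↑(-2 * π * (σ - u) * ξ) * I) • φ u) volume σ
    rw [← this]
    refine integral_congr_ae (ae_of_all _ fun v => ?_)
    simp only [sub_sub_cancel]
  rw [hsub, ← integral_const_mul]
  refine integral_congr_ae (ae_of_all _ fun u => ?_)
  simp only [smul_eq_mul]
  rw [← mul_assoc, ← Complex.exp_add]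
  congr 1
  congr 1
  push_cast
  ring

/-- The moduli agree: `‖𝓕(v ↦ φ(σ - v))(ξ)‖ = ‖𝓕⁻φ(ξ)‖`. [folklore] -/
theorem norm_fourier_comp_const_sub (φ : ℝ → ℂ) (σ ξ : ℝ) :
    ‖𝓕 (fun v : ℝ => φ (σ - v)) ξ‖ = ‖(𝓕⁻ φ : ℝ → ℂ) ξ‖ := by
  rw [fourier_comp_const_sub, norm_mul, Complex.norm_exp_ofReal_mul_I, one_mul]

/-- `L²` functions are integrable on sets of finite measure. [folklore] -/
theorem MemLp.integrable_indicator_of_measure_lt_top {φ : ℝ → ℂ} (hφ : MemLp φ 2 volume)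
    {S : Set ℝ} (hS : MeasurableSet S) (hSfin : volume S < ⊤) :
    Integrable (S.indicator φ) := by
  rw [integrable_indicator_iff hS]
  haveI : IsFiniteMeasure (volume.restrict S) := ⟨by rwa [Measure.restrict_apply_univ]⟩
  exact (hφ.restrict S).integrable one_le_two

/-- **Packaging the multiplier.** Let `φ, g ∈ L²` be a spectral/boundary pair: `φ = 0` on
`(-∞,0)` and a.e. on `(2σ, ∞)`, and `g = 𝓕⁻ φ'` a.e. for every integrable `φ' = φ` a.e. If
`‖g‖ ≤ W` a.e. with `W` continuous and `‖g‖ ≥ m` a.e. on an interval `(a, b) ⊂ [-1, 1]`, then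
`ψ(x) = (1_{[0,2σ]} φ)(σ - x)` is in `L¹ ∩ L²`, vanishes for `|x| > σ`, and satisfies
`‖𝓕ψ‖ ≤ W` everywhere and `(b - a) m² ≤ ∫_{[-1,1]} ‖𝓕ψ‖²`. [folklore] -/
theorem exists_multiplier_of_boundary {φ g : ℝ → ℂ} (hφ : MemLp φ 2 volume)
    (hzero : ∀ ξ, ξ < 0 → φ ξ = 0) {σ : ℝ} (hzero' : ∀ᵐ ζ : ℝ, 2 * σ < ζ → φ ζ = 0)
    (hrepr : ∀ φ' : ℝ → ℂ, φ' =ᵐ[volume] φ → Integrable φ' → g =ᵐ[volume] 𝓕⁻ φ')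
    {W : ℝ → ℝ} (hW : Continuous W) (hgW : ∀ᵐ ξ : ℝ, ‖g ξ‖ ≤ W ξ)
    {a b m : ℝ} (hab : a < b) (hsub : Ioo a b ⊆ Icc (-1 : ℝ) 1) (hm : 0 ≤ m)
    (hgm : ∀ᵐ ξ : ℝ, ξ ∈ Ioo a b → m ≤ ‖g ξ‖) :
    ∃ ψ : ℝ → ℂ, Integrable ψ ∧ MemLp ψ 2 volume ∧ (∀ x, σ < |x| → ψ x = 0) ∧
      (∀ ξ, ‖𝓕 ψ ξ‖ ≤ W ξ) ∧ (b - a) * m ^ 2 ≤ ∫ ξ in Icc (-1 : ℝ) 1, ‖𝓕 ψ ξ‖ ^ 2 := by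
  -- the truncated spectral function
  set S : Set ℝ := Icc 0 (2 * σ) with hS
  set φ' : ℝ → ℂ := S.indicator φ with hφ'
  have hφ'eq : φ' =ᵐ[volume] φ := by
    filter_upwards [hzero'] with ζ hζ
    rw [hφ']
    by_cases hmem : ζ ∈ S
    · rw [indicator_of_mem hmem]
    · rw [indicator_of_notMem hmem]
      rw [hS, mem_Icc, not_and_or, not_le, not_le] at hmem
      rcases hmem with h | h
      · exact (hzero ζ h).symm
      · exact (hζ h).symm
  have hφ'int : Integrable φ' :=
    MemLp.integrable_indicator_of_measure_lt_top hφ measurableSet_Icc measure_Icc_lt_top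
  have hφ'L2 : MemLp φ' 2 volume := hφ.indicator measurableSet_Icc
  have hgφ' : g =ᵐ[volume] 𝓕⁻ φ' := hrepr φ' hφ'eq hφ'int
  -- the multiplier
  set ψ : ℝ → ℂ := fun x => φ' (σ - x) with hψ
  have hψint : Integrable ψ := hφ'int.comp_sub_left σ
  have hψL2 : MemLp ψ 2 volume := hφ'L2.comp_measurePreserving (Measure.measurePreserving_sub_left volume σ)
  have hψsupp : ∀ x, σ < |x| → ψ x = 0 := by
    intro x hx
    rw [hψ]
    simp only [hφ']
    refine indicator_of_notMem ?_ _
    rw [hS, mem_Icc, not_and_or, not_le, not_le]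
    rcases lt_or_ge 0 x with h | h
    · rw [abs_of_pos h] at hx; left; linarith
    · rw [abs_of_nonpos h] at hx; right; linarith
  -- moduli of the Fourier transform
  have hnorm : ∀ ξ, ‖𝓕 ψ ξ‖ = ‖(𝓕⁻ φ' : ℝ → ℂ) ξ‖ := fun ξ => norm_fourier_comp_const_sub φ' σ ξ
  have hnorm_ae : ∀ᵐ ξ : ℝ, ‖𝓕 ψ ξ‖ = ‖g ξ‖ := by
    filter_upwards [hgφ'] with ξ hξ
    rw [hnorm, hξ]
  have hcont : Continuous fun ξ => ‖𝓕 ψ ξ‖ :=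
    (Literature.Analysis.FunctionSpaces.continuous_fourierIntegral hψint).norm
  refine ⟨ψ, hψint, hψL2, hψsupp, ?_, ?_⟩
  · -- everywhere bound by continuity
    refine le_of_ae_le_of_continuous hcont hW ?_
    filter_upwards [hnorm_ae, hgW] with ξ h1 h2
    rw [h1]; exact h2
  · -- lower bound on `(a, b)`
    have hmeas : MemLp (𝓕 ψ) 2 volume :=
      Literature.Analysis.FunctionSpaces.memLp_two_fourierIntegral hψint hψL2
    have hi : Integrable (fun ξ => ‖𝓕 ψ ξ‖ ^ 2) := (memLp_two_iff_integrable_sq_norm hmeas.1).1 hmeas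
    calc (b - a) * m ^ 2 = ∫ _ in Ioo a b, m ^ 2 := by
          rw [setIntegral_const, Real.volume_real_Ioo, max_eq_left (by linarith), smul_eq_mul]
      _ ≤ ∫ ξ in Ioo a b, ‖𝓕 ψ ξ‖ ^ 2 := by
          refine setIntegral_mono_on_ae (integrableOn_const measure_Ioo_lt_top.ne) hi.integrableOn
            measurableSet_Ioo ?_
          filter_upwards [hnorm_ae, hgm] with ξ h1 h2 hξ
          rw [h1]
          have := h2 hξ
          exact pow_le_pow_left₀ hm this 2
      _ ≤ ∫ ξ in Icc (-1 : ℝ) 1, ‖𝓕 ψ ξ‖ ^ 2 :=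
          setIntegral_mono_set hi.integrableOn (ae_of_all _ fun ξ => by positivity) hsub.eventuallyLE

end Packaging

end Literature.Analysis.Fourier
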